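import Literature.NumberTheory.EllipticCurves.AnticyclotomicSignedTransferTheorem
import Literature.NumberTheory.GaloisRepresentations.NearlyOrdinaryPresentationProofs
import Literature.AlgebraicGeometry.Resolution.RegularLocalRingsNormal
import Literature.NumberTheory.EllipticCurves.CastellaGrossiSkinner2025.GreenbergAnticyclotomicMainConjectureProofs
import Summits.BirchSwinnertonDyer.BirchSwinnertonDyer.Theorems.SignedBaseChangeK2RDivisibilityDescent
import HarnessLib

/-!
# Rigidity of the class binder of `AcSigned.TransferInputs`: two classes admitted for the same
# `L` differ by a unit of `Λ` — so the research stub `stub_signedEisensteinSS_mult` of line `bdpline`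
# (crux `AnticyclotomicEisensteinDivisibility`, stmt-BirchSwinnertonDyer-20727) is a statement about
# canonical objects

Lead seat bsd-line-sbc-p1 (gen 13), `--supports stmt-BirchSwinnertonDyer-20727`. The registered research
stub `stub_signedEisensteinSS_mult` (Form T: the Eisenstein inclusion of Castella–Wan's signed
Heegner-point statement 4.8 (3), sign `+`, up to `p^k`) quantifies over an AUXILIARY class
`z ∈ Sel_ε(K, 𝐓^ac)` and a series `L ∈ R₀⟦T⟧` bound only by the hypothesis structure
`AcSigned.TransferInputs … ε z L` (Castella–Wan 2024, proof of Thm. 6.8: (6.12), (6.13), Lemma 6.7 (2),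
Def. 6.1 + Thm. 6.2 as ideals, Cor. 6.4) and `IsCWBDPLFunction … L`; its conclusion
`(p^k)·char(X_{ε,tors}) ⊆ ι(char(Sel_ε/Λz))²` names `z` through `signedHeegnerCharIdeal hγ ε z`. Before the
stub is promoted to an item one should know whether its truth value could depend on WHICH admissible
`z` is taken. THIS FILE proves it cannot: under the Howard-side injectivity of `loc_𝔭` on `Sel_ε(K, 𝐓^ac)`
("`Sel^{str,ε} = 0`", the tree theorem `TransferInputs.locSignedAt_injective` from `Λ`-rank one of
`Sel_ε`, Longo–Vigni 2019 Thm. 1.4 / Castella–Wan Lemma 6.7 (1)), ANY TWO classes `z, z'` with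
`TransferInputs … ε z L` and `TransferInputs … ε z' L` satisfy `z' = u • z` for a unit `u ∈ Λˣ`; hence
`Λz' = Λz`, `signedHeegnerCharIdeal hγ ε z' = signedHeegnerCharIdeal hγ ε z`, and the Form-T conclusion
for `z` and for `z'` are the same proposition.

## The argument (pure algebra on the typed fields; Castella–Wan never need it because their `z` is
## THE class `z^±_∞`)

* Two signed logarithms `Log, Log' : H¹_ε(K_𝔭, 𝐓^ac) → Λ` (`IsSignedLog`: `Λ`-linear bijections) differ
  by a unit: `Log' = c · Log`, `c ∈ Λˣ` (coordinate maps of a free rank-one module).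
* The explicit reciprocity law field `signedLog_erl` for `(z, L)` and for `(z', L)` along one
  structure map `j : ℤ_p → R₀` gives `ι(Log loc_𝔭 z)²·R₀⟦T⟧ = (L) = ι(Log' loc_𝔭 z')²·R₀⟦T⟧`.
* Divisibility DESCENDS from `R₀⟦T⟧` (indeed from `𝒪_{ℂ_p}⟦T⟧`) to `Λ = ℤ_p⟦T⟧` (tree:
  `iwasawaAlgebra_dvd_of_map_dvd_map_padicComplexInt`, Weierstrass division), so `(Log loc_𝔭 z)²` and
  `(Log' loc_𝔭 z')²` are associated in `Λ` (`ι` is an involutive ring automorphism).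
* `Λ = ℤ_p⟦T⟧` is a regular local ring, hence INTEGRALLY CLOSED (tree: Matsumura 19.4/19.5 via
  `isRegularLocalRing_mvPowerSeries_dvr`, `isIntegrallyClosed_of_isRegularLocalRing`), so associated
  squares have associated roots (Mathlib `Associated.pow_iff`): `Log loc_𝔭 z' = w · Log loc_𝔭 z`, `w ∈ Λˣ`.
* `Log` is injective and `Λ`-linear, `loc_𝔭` is `Λ`-linear (`locSignedAt_smul`) and injective on `Sel_ε`
  (hypothesis), so `z' = w • z`.

## Contents (all PROVED, standard axioms; no definition, no named fact, no `sorry`)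

* §1 `isRegularLocalRing_iwasawaAlgebra`, `isIntegrallyClosed_iwasawaAlgebra`, `associated_of_sq_dvd_sq`,
  `associated_of_span_map_eq` (descent of an equality of extended principal ideals along `j : ℤ_p → R₀`).
* §2 `IsSignedLog.exists_units_eq_mul` — uniqueness of the signed logarithm up to `Λˣ`.
* §3 `TransferInputs.exists_units_smul_eq` — THE RIGIDITY; `…_of_hasRank` (rank-one form);
  `TransferInputs.span_singleton_eq`.
* §4 `TransferInputs.signedHeegnerCharIdeal_eq`, `TransferInputs.formT_iff` — the Form-T conclusion of
  `stub_signedEisensteinSS_mult` is independent of the admissible class (base change `W⁄K`, any sign).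
Nothing about elliptic curves is asserted unconditionally; BSD / the crux are NOT proved by this file.
-/
-- D-0017: single-problem summit, the namespace repeats the problem name by design.
set_option linter.dupNamespace false
set_option autoImplicit false

noncomputable section

open scoped Classical

open PowerSeries NumberField IsDedekindDomain Field
open Literature.NumberTheory.EllipticCurves Literature.NumberTheory.GaloisRepresentations
open Literature.NumberTheory.EllipticCurves.AcSigned

universe u

namespace Summit.BirchSwinnertonDyer.BirchSwinnertonDyer.Theorems.SignedBaseChangeAcDivTransferClassRigidity

/-! ## §1 Algebra in `Λ = ℤ_p⟦T⟧`: normality, associated squares, descent along `j : ℤ_p → R₀` -/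

section Algebra

variable (p : ℕ) [Fact p.Prime]

/-- **`Λ = ℤ_p⟦T⟧` is a regular local ring** (it is `ℤ_p⟦X₀⟧`, regular of dimension `2`).
[cite: Matsumura1987, Thm. 19.5 and Thm. 15.4] -/
theorem isRegularLocalRing_iwasawaAlgebra : IsRegularLocalRing (IwasawaAlgebra p) :=
  haveI := NearlyOrdinaryPresentationCA.isRegularLocalRing_mvPowerSeries_dvr ℤ_[p] 1
  IsRegularLocalRing.of_ringEquiv
    (MvPowerSeries.renameEquiv ℤ_[p] finOneEquiv.symm).toRingEquiv.symm

/-- **`Λ = ℤ_p⟦T⟧` is integrally closed** (regular local rings are normal).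
[cite: Matsumura1987, Thm. 19.4] -/
theorem isIntegrallyClosed_iwasawaAlgebra : IsIntegrallyClosed (IwasawaAlgebra p) :=
  haveI := isRegularLocalRing_iwasawaAlgebra p
  Literature.AlgebraicGeometry.Resolution.isIntegrallyClosed_of_isRegularLocalRing _

variable {p}

/-- **Associated squares have associated roots in `Λ`**: `a² ∣ b²` and `b² ∣ a²` give `a ~ b`
(`Λ` is an integrally closed domain). [cite: Matsumura1987, Thm. 19.4 (normality of regular local rings)] -/
theorem associated_of_sq_dvd_sq {a b : IwasawaAlgebra p} (h₁ : a ^ 2 ∣ b ^ 2) (h₂ : b ^ 2 ∣ a ^ 2) :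
    Associated a b :=
  haveI := isIntegrallyClosed_iwasawaAlgebra p
  (Associated.pow_iff two_ne_zero).mp (dvd_dvd_iff_associated.mp ⟨h₁, h₂⟩)

/-- **Descent of an equality of extended principal ideals along `j : ℤ_p → R₀`.** If
`(a)·R₀⟦T⟧ = (b)·R₀⟦T⟧` for a structure map `j` compatible with `ℤ_p ⊂ ℚ_p ⊂ ℂ_p`, then `a ~ b` in
`Λ = ℤ_p⟦T⟧`: push the two divisibilities to `𝒪_{ℂ_p}⟦T⟧` along `R₀ ⊆ 𝒪_{ℂ_p}` and descend them with
`iwasawaAlgebra_dvd_of_map_dvd_map_padicComplexInt` (Weierstrass division over `ℤ_p`).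
[cite: Washington1997, Prop. 7.2 and Thm. 7.3 (Weierstrass division / preparation)]
[cite: Castella2018, §3 (R₀ ⊂ 𝒪_{ℂ_p}, arXiv:1704.06608 p. 9)] -/
theorem associated_of_span_map_eq {j : ℤ_[p] →+* unrIntegers p}
    (hj : ∀ x : ℤ_[p], ((j x : unrIntegers p) : ℂ_[p]) = algebraMap ℚ_[p] ℂ_[p] (x : ℚ_[p]))
    {a b : IwasawaAlgebra p}
    (h : (Ideal.span {a}).map (PowerSeries.map j) = (Ideal.span {b}).map (PowerSeries.map j)) :
    Associated a b := by
  obtain ⟨J₀, hJ₀⟩ := exists_ringHom_unrIntegers_padicComplexInt (p := p)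
  have hJ : ∀ x : ℤ_[p], (((J₀.comp j) x : PadicComplexInt p) : ℂ_[p]) = ((x : ℚ_[p]) : ℂ_[p]) := by
    intro x
    rw [RingHom.comp_apply, hJ₀, hj]
    rfl
  rw [Ideal.map_span, Ideal.map_span, Set.image_singleton, Set.image_singleton] at h
  have hba : PowerSeries.map j b ∣ PowerSeries.map j a := Ideal.span_singleton_le_span_singleton.mp h.le
  have hab : PowerSeries.map j a ∣ PowerSeries.map j b := Ideal.span_singleton_le_span_singleton.mp h.ge
  have key : ∀ {x y : IwasawaAlgebra p}, PowerSeries.map j x ∣ PowerSeries.map j y → x ∣ y := by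
    intro x y hxy
    refine SignedBaseChangeK2RDivisibilityDescent.iwasawaAlgebra_dvd_of_map_dvd_map_padicComplexInt hJ ?_
    rw [PowerSeries.map_comp, RingHom.comp_apply, RingHom.comp_apply]
    exact map_dvd (PowerSeries.map J₀) hxy
  exact dvd_dvd_iff_associated.mp ⟨key hab, key hba⟩

end Algebra

/-! ## §2 The signed logarithm is unique up to a unit of `Λ` -/

section SignedLog

variable {K : Type u} [Field K] [NumberField K] {W : WeierstrassCurve K} {p : ℕ} [Fact p.Prime]
  {κ : ZpExtension K p} {γ : absoluteGaloisGroup K} {hγ : κ.IsTopGenerator γ}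
  {𝔭 : HeightOneSpectrum (𝓞 K)} {h𝔭 : IsNonsplitIn κ 𝔭} {γ𝔭 : absoluteGaloisGroup (𝔭.adicCompletion K)}
  {hγ𝔭 : κ (resGalOfEmb (closureEmb (K := K) (𝔭.adicCompletion K)) γ𝔭) = κ γ} {ε : ℤˣ}

set_option synthInstance.maxHeartbeats 200000 in
/-- **Two signed logarithms differ by a unit**: if `Log, Log' : H¹_ε(K_𝔭, 𝐓^ac) → Λ` are both
`Λ`-linear bijections (`IsSignedLog`, Castella–Wan Def. 6.1: the coordinate map of a basis `a^±` of
the free rank-one module `H¹_±(K_𝔭, 𝐓^ac)`), then `Log' = c · Log` for some `c ∈ Λˣ` — print's remark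
that `Log^±` depends on the choice of `a^±` (through the element `d` of Lemma 3.4) only up to a unit,
so that every IDEAL statement is independent of it.
[cite: CastellaWan2023, Def. 6.1 and §6.1 (MS pp. 25–26), Prop. 3.11 (MS p. 15)] -/
theorem IsSignedLog.exists_units_eq_mul
    {Log Log' : localSignedLambdaAdic (W.baseChange (𝔭.adicCompletion K)) p (localizeAt κ 𝔭 h𝔭) γ𝔭 ε →+
      IwasawaAlgebra p}
    (hLog : IsSignedLog W p κ γ hγ 𝔭 h𝔭 γ𝔭 hγ𝔭 ε Log) (hLog' : IsSignedLog W p κ γ hγ 𝔭 h𝔭 γ𝔭 hγ𝔭 ε Log') :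
    ∃ c : (IwasawaAlgebra p)ˣ, ∀ y, Log' y = (c : IwasawaAlgebra p) * Log y := by
  letI iH : Module (IwasawaAlgebra p) (localSignedLambdaAdic (W.baseChange (𝔭.adicCompletion K)) p
      (localizeAt κ 𝔭 h𝔭) γ𝔭 ε) :=
    localSignedLambdaAdic.moduleOfGen (W.baseChange (𝔭.adicCompletion K)) p (localizeAt κ 𝔭 h𝔭)
      γ𝔭 (isTopGenerator_localize_of_apply_eq p κ _ h𝔭 hγ𝔭 hγ) ε
  obtain ⟨hlin, hbij⟩ := hLog
  obtain ⟨hlin', hbij'⟩ := hLog'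
  obtain ⟨y₁, hy₁⟩ := hbij.2 1
  obtain ⟨y₁', hy₁'⟩ := hbij'.2 1
  -- every `y` is `(Log y) • y₁`
  have hrepr : ∀ y : localSignedLambdaAdic (W.baseChange (𝔭.adicCompletion K)) p (localizeAt κ 𝔭 h𝔭) γ𝔭 ε,
      y = ((Log y : IwasawaAlgebra p) • y₁ :
        localSignedLambdaAdic (W.baseChange (𝔭.adicCompletion K)) p (localizeAt κ 𝔭 h𝔭) γ𝔭 ε) :=
    fun y ↦ hbij.1 (by rw [hlin, hy₁, mul_one])
  have hc : ∀ y, Log' y = Log' y₁ * Log y := fun y ↦ by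
    conv_lhs => rw [hrepr y]
    rw [hlin', mul_comm]
  have hunit : IsUnit (Log' y₁) := by
    refine IsUnit.of_mul_eq_one (Log y₁') ?_
    rw [← hc, hy₁']
  exact ⟨hunit.unit, fun y ↦ by rw [IsUnit.unit_spec]; exact hc y⟩

end SignedLog

/-! ## §3 The rigidity: `TransferInputs … z L ∧ TransferInputs … z' L ⟹ z' = u • z`, `u ∈ Λˣ` -/

section Rigidity

variable {K : Type u} [Field K] [NumberField K] {W : WeierstrassCurve K} {p : ℕ} [Fact p.Prime]
  {κ : ZpExtension K p} {γ : absoluteGaloisGroup K} {hγ : κ.IsTopGenerator γ}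
  {𝔭 : HeightOneSpectrum (𝓞 K)} {h𝔭 : IsNonsplitIn κ 𝔭} {γ𝔭 : absoluteGaloisGroup (𝔭.adicCompletion K)}
  {hγ𝔭 : κ (resGalOfEmb (closureEmb (K := K) (𝔭.adicCompletion K)) γ𝔭) = κ γ}
  {𝔭' : HeightOneSpectrum (𝓞 K)} {h𝔭𝔭' : 𝔭 ≠ 𝔭'} {h𝔭p : ((p : ℕ) : 𝓞 K) ∈ 𝔭.asIdeal} {ε : ℤˣ}
  {z z' : selmerLambdaAdic W p κ γ (fun _ ↦ .sgn ε)} {L : UnrSeries p}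

set_option synthInstance.maxHeartbeats 200000 in
/-- **Rigidity of the class binder of `TransferInputs`.** If `z` and `z'` both satisfy Castella–Wan's
typed inputs `TransferInputs … ε · L` for the SAME `L` (so each comes with a signed logarithm whose
explicit reciprocity law (Thm. 6.2, ideal form) reads `(L) = ι((Log loc_𝔭 ·)²)·R₀⟦T⟧`), and `loc_𝔭` is
injective on `Sel_ε(K, 𝐓^ac)` ("`Sel^{str,±} = 0`", proof of Thm. 6.8), then `z' = u • z` for a unit
`u ∈ Λˣ`. Proof: module docstring (uniqueness of `Log` up to `Λˣ`; descent of the two ERL identities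
from `R₀⟦T⟧` to `Λ`; normality of `Λ`; injectivity of `Log` and of `loc_𝔭`).
[cite: CastellaWan2023, Def. 6.1, Thm. 6.2, Cor. 6.4 and proof of Thm. 6.8 (MS pp. 25–31)] -/
theorem TransferInputs.exists_units_smul_eq
    (h : TransferInputs W p κ γ hγ 𝔭 h𝔭 γ𝔭 hγ𝔭 𝔭' h𝔭𝔭' h𝔭p ε z L)
    (h' : TransferInputs W p κ γ hγ 𝔭 h𝔭 γ𝔭 hγ𝔭 𝔭' h𝔭𝔭' h𝔭p ε z' L)
    (hinj : Function.Injective (locSignedAt W p κ 𝔭 h𝔭 γ γ𝔭 hγ𝔭 (fun _ ↦ .sgn ε) ε rfl h𝔭p)) :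
    letI := selmerLambdaAdic.moduleOfGen W p κ γ hγ (fun _ ↦ PCond.sgn ε)
    ∃ u : (IwasawaAlgebra p)ˣ, z' = (u : IwasawaAlgebra p) • z := by
  letI iS : Module (IwasawaAlgebra p) (selmerLambdaAdic W p κ γ (fun _ ↦ .sgn ε)) :=
    selmerLambdaAdic.moduleOfGen W p κ γ hγ (fun _ ↦ PCond.sgn ε)
  letI iH : Module (IwasawaAlgebra p) (localSignedLambdaAdic (W.baseChange (𝔭.adicCompletion K)) p
      (localizeAt κ 𝔭 h𝔭) γ𝔭 ε) :=
    localSignedLambdaAdic.moduleOfGen (W.baseChange (𝔭.adicCompletion K)) p (localizeAt κ 𝔭 h𝔭)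
      γ𝔭 (isTopGenerator_localize_of_apply_eq p κ _ h𝔭 hγ𝔭 hγ) ε
  obtain ⟨Log, hLog, hL⟩ := h.signedLog_erl
  obtain ⟨Log', hLog', hL'⟩ := h'.signedLog_erl
  obtain ⟨j, hj⟩ := exists_ringHom_padicInt_unrIntegers (p := p)
  set lz := locSignedAt W p κ 𝔭 h𝔭 γ γ𝔭 hγ𝔭 (fun _ ↦ .sgn ε) ε rfl h𝔭p z with hlz
  set lz' := locSignedAt W p κ 𝔭 h𝔭 γ γ𝔭 hγ𝔭 (fun _ ↦ .sgn ε) ε rfl h𝔭p z' with hlz'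
  -- the two explicit reciprocity laws along the same `j`
  have e : (Ideal.span {IwasawaAlgebra.invol p (Log lz ^ 2)}).map (PowerSeries.map j) =
      (Ideal.span {IwasawaAlgebra.invol p (Log' lz' ^ 2)}).map (PowerSeries.map j) :=
    (hL j hj).symm.trans (hL' j hj)
  -- descend to `Λ` and remove the involution
  have hι : Associated (IwasawaAlgebra.invol p (Log lz ^ 2)) (IwasawaAlgebra.invol p (Log' lz' ^ 2)) :=
    associated_of_span_map_eq hj e
  have h2 : Associated (Log lz ^ 2) (Log' lz' ^ 2) := by
    have := hι.map (IwasawaAlgebra.invol p)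
    rwa [IwasawaAlgebra.invol_invol, IwasawaAlgebra.invol_invol] at this
  -- associated squares ⟹ associated (normality of `Λ`)
  obtain ⟨u, hu⟩ := associated_of_sq_dvd_sq h2.dvd h2.symm.dvd
  -- the two logarithms differ by a unit `c`
  obtain ⟨c, hc⟩ := IsSignedLog.exists_units_eq_mul hLog hLog'
  -- hence `Log lz' = w · Log lz` with `w = c⁻¹ u`
  have hw : Log lz' = ((c⁻¹ * u : (IwasawaAlgebra p)ˣ) : IwasawaAlgebra p) * Log lz := by
    have h1 : (c : IwasawaAlgebra p) * Log lz' = Log lz * u := by rw [← hc, hu]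
    calc Log lz' = ((c⁻¹ : (IwasawaAlgebra p)ˣ) : IwasawaAlgebra p) * ((c : IwasawaAlgebra p) * Log lz') := by
          rw [← mul_assoc, Units.inv_mul, one_mul]
      _ = ((c⁻¹ * u : (IwasawaAlgebra p)ˣ) : IwasawaAlgebra p) * Log lz := by
          rw [h1, Units.val_mul]; ring
  -- `Log` is injective and linear: `lz' = w • lz`
  have hloc : lz' = ((c⁻¹ * u : (IwasawaAlgebra p)ˣ) : IwasawaAlgebra p) • lz :=
    hLog.2.1 (by rw [hLog.1, ← hw])
  -- `loc_𝔭` is linear and injective on `Sel_ε`: `z' = w • z`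
  refine ⟨c⁻¹ * u, hinj ?_⟩
  rw [locSignedAt_smul W p κ 𝔭 h𝔭 hγ𝔭 hγ rfl h𝔭p, ← hlz, ← hlz', hloc]

set_option synthInstance.maxHeartbeats 200000 in
/-- **Rigidity, rank-one form**: with the Howard-side hypothesis "`Sel_ε(K, 𝐓^ac)` is finitely generated
of `Λ`-rank one" (Castella–Wan Conj. 4.8 (2) / Thm. 6.8 (i) / Lemma 6.7 (1); Longo–Vigni 2019 Thm. 1.4 in
the line), the injectivity of `loc_𝔭` is the tree theorem `TransferInputs.locSignedAt_injective`, so any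
two admissible classes for the same `L` differ by a unit. [cite: CastellaWan2023, proof of Thm. 6.8 (MS p. 30)]
[cite: LongoVigni2019, Thm. 1.4] -/
theorem TransferInputs.exists_units_smul_eq_of_hasRank
    (h : TransferInputs W p κ γ hγ 𝔭 h𝔭 γ𝔭 hγ𝔭 𝔭' h𝔭𝔭' h𝔭p ε z L)
    (h' : TransferInputs W p κ γ hγ 𝔭 h𝔭 γ𝔭 hγ𝔭 𝔭' h𝔭𝔭' h𝔭p ε z' L)
    (hrank : selmerLambdaAdic.HasRank W p κ γ hγ (fun _ ↦ .sgn ε) 1) :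
    letI := selmerLambdaAdic.moduleOfGen W p κ γ hγ (fun _ ↦ PCond.sgn ε)
    ∃ u : (IwasawaAlgebra p)ˣ, z' = (u : IwasawaAlgebra p) • z :=
  TransferInputs.exists_units_smul_eq h h' (h.locSignedAt_injective hrank)

set_option synthInstance.maxHeartbeats 200000 in
/-- **The cyclic submodules agree**: `Λ z' = Λ z` for any two admissible classes (same `L`, `loc_𝔭`
injective on `Sel_ε`). [cite: CastellaWan2023, proof of Thm. 6.8 (MS pp. 30–31)] -/
theorem TransferInputs.span_singleton_eq
    (h : TransferInputs W p κ γ hγ 𝔭 h𝔭 γ𝔭 hγ𝔭 𝔭' h𝔭𝔭' h𝔭p ε z L)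
    (h' : TransferInputs W p κ γ hγ 𝔭 h𝔭 γ𝔭 hγ𝔭 𝔭' h𝔭𝔭' h𝔭p ε z' L)
    (hinj : Function.Injective (locSignedAt W p κ 𝔭 h𝔭 γ γ𝔭 hγ𝔭 (fun _ ↦ .sgn ε) ε rfl h𝔭p)) :
    letI := selmerLambdaAdic.moduleOfGen W p κ γ hγ (fun _ ↦ PCond.sgn ε)
    Submodule.span (IwasawaAlgebra p) {z'} = Submodule.span (IwasawaAlgebra p) {z} := by
  letI iS : Module (IwasawaAlgebra p) (selmerLambdaAdic W p κ γ (fun _ ↦ .sgn ε)) :=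
    selmerLambdaAdic.moduleOfGen W p κ γ hγ (fun _ ↦ PCond.sgn ε)
  obtain ⟨u, hu⟩ := TransferInputs.exists_units_smul_eq h h' hinj
  rw [hu]
  exact Submodule.span_singleton_smul_eq u.isUnit z

end Rigidity

/-! ## §4 The reading for a base change `W⁄K`: the Form-T conclusion does not depend on the class -/

section BaseChange

variable {K : Type} [Field K] [NumberField K] {W : WeierstrassCurve ℚ} {p : ℕ} [Fact p.Prime]
  {κ : ZpExtension K p} {γ : absoluteGaloisGroup K} {hγ : κ.IsTopGenerator γ}
  {𝔭 : HeightOneSpectrum (𝓞 K)} {h𝔭 : IsNonsplitIn κ 𝔭} {γ𝔭 : absoluteGaloisGroup (𝔭.adicCompletion K)}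
  {hγ𝔭 : κ (resGalOfEmb (closureEmb (K := K) (𝔭.adicCompletion K)) γ𝔭) = κ γ}
  {𝔭' : HeightOneSpectrum (𝓞 K)} {h𝔭𝔭' : 𝔭 ≠ 𝔭'} {h𝔭p : ((p : ℕ) : 𝓞 K) ∈ 𝔭.asIdeal} {ε : ℤˣ}
  {z z' : selmerLambdaAdic (W.baseChange K) p κ γ (fun _ ↦ .sgn ε)} {L : UnrSeries p}

set_option synthInstance.maxHeartbeats 200000 in
/-- **`char_Λ(Sel_ε(K, 𝐓^ac)/Λ z') = char_Λ(Sel_ε(K, 𝐓^ac)/Λ z)`** for any two classes admitted by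
`TransferInputs` for the same `L` (`loc_𝔭` injective on `Sel_ε`): the right-hand side of Castella–Wan's
4.8 (3) in the tree's currency `signedHeegnerCharIdeal` is independent of the admissible class.
[cite: CastellaWan2023, Conj. 4.8 (3) and proof of Thm. 6.8 (MS pp. 22, 30–31)] -/
theorem TransferInputs.signedHeegnerCharIdeal_eq
    (h : TransferInputs (W.baseChange K) p κ γ hγ 𝔭 h𝔭 γ𝔭 hγ𝔭 𝔭' h𝔭𝔭' h𝔭p ε z L)
    (h' : TransferInputs (W.baseChange K) p κ γ hγ 𝔭 h𝔭 γ𝔭 hγ𝔭 𝔭' h𝔭𝔭' h𝔭p ε z' L)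
    (hinj : Function.Injective
      (locSignedAt (W.baseChange K) p κ 𝔭 h𝔭 γ γ𝔭 hγ𝔭 (fun _ ↦ .sgn ε) ε rfl h𝔭p)) :
    signedHeegnerCharIdeal hγ ε z' = signedHeegnerCharIdeal hγ ε z := by
  unfold signedHeegnerCharIdeal
  rw [TransferInputs.span_singleton_eq h h' hinj]

set_option synthInstance.maxHeartbeats 200000 in
/-- **The Form-T conclusion of `stub_signedEisensteinSS_mult` is independent of the admissible class**:
for any two classes `z, z'` admitted by `TransferInputs` for the same `L` (`loc_𝔭` injective on `Sel_ε`),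
`∃ k, (p^k)·char(X_{ε,tors}) ⊆ ι(char(Sel_ε/Λz))²` holds for `z` iff it holds for `z'` — the registered
research statement is a statement about canonical objects (the class pinned by `L` up to `Λˣ`).
[cite: CastellaWan2023, Conj. 4.8 (3), Thm. 6.8 and its proof (MS pp. 22, 29–31)] -/
theorem TransferInputs.formT_iff
    (h : TransferInputs (W.baseChange K) p κ γ hγ 𝔭 h𝔭 γ𝔭 hγ𝔭 𝔭' h𝔭𝔭' h𝔭p ε z L)
    (h' : TransferInputs (W.baseChange K) p κ γ hγ 𝔭 h𝔭 γ𝔭 hγ𝔭 𝔭' h𝔭𝔭' h𝔭p ε z' L)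
    (hinj : Function.Injective
      (locSignedAt (W.baseChange K) p κ 𝔭 h𝔭 γ γ𝔭 hγ𝔭 (fun _ ↦ .sgn ε) ε rfl h𝔭p)) :
    (∃ k : ℕ, Ideal.span {((p : ℕ) : IwasawaAlgebra p) ^ k} *
        X.torsionCharIdeal (W.baseChange K) p κ ∅ (fun _ ↦ .sgn ε) hγ ≤
      (signedHeegnerCharIdeal hγ ε z).map (IwasawaAlgebra.invol p) ^ 2) ↔
    (∃ k : ℕ, Ideal.span {((p : ℕ) : IwasawaAlgebra p) ^ k} *
        X.torsionCharIdeal (W.baseChange K) p κ ∅ (fun _ ↦ .sgn ε) hγ ≤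
      (signedHeegnerCharIdeal hγ ε z').map (IwasawaAlgebra.invol p) ^ 2) := by
  rw [TransferInputs.signedHeegnerCharIdeal_eq h h' hinj]

set_option synthInstance.maxHeartbeats 200000 in
/-- **Rank-one form of the invariance** (the hypothesis the line actually holds: `Sel_ε(K, 𝐓^ac)` f.g. of
`Λ`-rank one, Longo–Vigni 2019 Thm. 1.4 / Castella–Wan Lemma 6.7 (1)).
[cite: CastellaWan2023, proof of Thm. 6.8 (MS p. 30)] [cite: LongoVigni2019, Thm. 1.4] -/
theorem TransferInputs.formT_iff_of_hasRank
    (h : TransferInputs (W.baseChange K) p κ γ hγ 𝔭 h𝔭 γ𝔭 hγ𝔭 𝔭' h𝔭𝔭' h𝔭p ε z L)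
    (h' : TransferInputs (W.baseChange K) p κ γ hγ 𝔭 h𝔭 γ𝔭 hγ𝔭 𝔭' h𝔭𝔭' h𝔭p ε z' L)
    (hrank : selmerLambdaAdic.HasRank (W.baseChange K) p κ γ hγ (fun _ ↦ .sgn ε) 1) :
    (∃ k : ℕ, Ideal.span {((p : ℕ) : IwasawaAlgebra p) ^ k} *
        X.torsionCharIdeal (W.baseChange K) p κ ∅ (fun _ ↦ .sgn ε) hγ ≤
      (signedHeegnerCharIdeal hγ ε z).map (IwasawaAlgebra.invol p) ^ 2) ↔
    (∃ k : ℕ, Ideal.span {((p : ℕ) : IwasawaAlgebra p) ^ k} *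
        X.torsionCharIdeal (W.baseChange K) p κ ∅ (fun _ ↦ .sgn ε) hγ ≤
      (signedHeegnerCharIdeal hγ ε z').map (IwasawaAlgebra.invol p) ^ 2) :=
  TransferInputs.formT_iff h h' (h.locSignedAt_injective hrank)

end BaseChange

end Summit.BirchSwinnertonDyer.BirchSwinnertonDyer.Theorems.SignedBaseChangeAcDivTransferClassRigidity

end
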